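import Literature.MathematicalPhysics.QuantumFieldTheory.Balaban1983to89.Node00.BgSchemeOfRecord
import HarnessLib

/-!
# [B11] Prop. 6 (117)–(121) at the scheme of record: THE `RegimeTok` DISCHARGER — the token of 3a read for `bgSchemeOfRecord` from the four
# printed inputs (117) `‖𝔊f‖ ≤ B₀‖f‖`, Prop. 4's quadratic-analytic `W`, (28) `‖J‖ ≤ C₁B₃ε₁`, (46)∕(103) `‖𝔄‖ < 2dL·B₀C₁ε₁` and the ceilings
# (118)–(121), by lit ✓`B11Eq174Chart.Regime.ofProp6`; and the inputs (28), (103) themselves read from 3d′ ∕ 3e′ ∕ 3f′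
# — OURS (glue over landed theorems; file 3i′ of the instance road; no inequality of Bałaban proved here)

Cell `pub-ymgap`, unit `pub-ymgap-node00-def-Y` (g37; owner∕custodian of the `OpsY` instance at the record; Node00 definition lane;
count-neutral, `--supports stmt-QuantumFields-27238`).  ★★★ director-ym №551 (N2) «name the `RegimeTok` glue» ∕ №553 «plus the `RegimeTok`
discharger named»: this file IS that discharger — `RegimeTok` (3a `BgScheme.RegimeTok` = `∀ V ∈ dom, Regime (𝒢 V) 0 (W V) B₀ 0 C₄ a₃ j a ε₄ ∧
‖J V‖ ≤ j ∧ ‖𝔄 V‖ < a`) for the instance `bgSchemeOfRecord` with the constant slots `j := C₁B₃ε₁`, `a := 2dL·B₀C₁ε₁` (Prop. 6's text), FROM: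
* (R1) (117) `‖𝔊(U₀)f‖ ≤ B₀‖f‖` for the slot-(c) `frakGOfRecordAtBg128` — [B9] Thm 3.13-type, N07 lane (HYPOTHESIS here);
* (R2) Prop. 4 (98): `QuadAnalytic (WOfRecordAt …) C₄ a₃` — N06 lane (HYPOTHESIS here);
* (R3) (28) `‖J(U₀)‖ ≤ C₁B₃ε₁` — 3d′ ✓`norm_JOfRecordAtBg_le` from lit's bondwise current clause `InU2cur` (§2 reads it);
* (R4) (46)∕(103) `‖𝔄(V)‖ < 2dL·B₀C₁ε₁` on the domain — §2 reads it from `‖H₁f‖ ≤ B₀‖f‖` (slot (c), HYPOTHESIS) and 3e′ ✓`norm_BOfRecord_lt` ((20)∕(1.37))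
  under the datum clause `|V(c)(Ū^kU₀)(c)⁻¹ − 1| ≤ C₁ε₁` of (14)∕(19);
* the ceilings «ε₄ ≤ a₄, 2B₀C₁B₃ε₁ ≤ ε₄» unfolded as in `Regime.ofProp6` (`4ε₄ ≤ a₃`, `16B₀C₄ε₄ ≤ 1`, `dL ≤ B₃`).
§1 the assembly from (R1)–(R4) as stated; §2 (R3), (R4) from the landed letters; §3 the assembly from the printed clauses at once.

HONEST LABELS.  Glue: `Regime.ofProp6` + two landed norm bounds; (R1), (R2), `‖H₁‖ ≤ B₀`, the datum∕current clauses and the ceilings are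
HYPOTHESES (displayed, never asserted); `ChartSUTok`, `HessSymmTok`, `C1Tok` are NOT touched (the last two are discharged Theorems-side,
✓`…N07SchemeTokensOfRecord`).  No `sorry`, no new axiom, no instance ∕ notation.  Nothing here is a claim about the Yang–Mills mass gap
(`Summit.QuantumFields`): finite torus, fixed `ε`; nothing continuum ∕ OS ∕ Clay.
-/

noncomputable section

open scoped Matrix Matrix.Norms.L2Operator InnerProductSpace ComplexConjugate

namespace Literature.MathematicalPhysics.QuantumFieldTheory.Balaban1983to89.Node00

open T4Continuum (T4Family)
open B9SectCLatticeCarrier (Bond)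
open B11Eq103H1Complex (BondL2K SiteL2K)
open B11Eq115Space (Space115 NegSize NegSup levWeight)
open B11Eq174Chart (Regime)
open B13Contraction113 (QuadAnalytic)
open B11Prop6Concrete (InU2cur)

section Record

variable (F : T4Family) (N : ℕ) [NeZero N] (K : ℕ) (k : ℕ) (Ω : ℕ → Set (Site (F.P K) 0)) (U₀ : GaugeField (F.P K) 0 (SU N))
variable [Fact (0 < (F.L : ℝ))] [Fact (0 < (F.P K).eta k)] [Fact (0 < c0Rec F K k)] [Fact (∀ c, 0 < wBRec F K k c)]

variable (dom : Set (GaugeField (F.P K) k (SU N))) (levB : PBond (F.P K) k → ℕ)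
  (Gp : SiteL2K ℂ (F.P K).d (fun _ => (F.P K).sitesPerDir 0) (c0Rec F K k) (WRec N) →ₗ[ℂ]
    SiteL2K ℂ (F.P K).d (fun _ => (F.P K).sitesPerDir 0) (c0Rec F K k) (WRec N))
  (Δ2 : BondL2K ℂ (F.P K).d (fun _ => (F.P K).sitesPerDir 0) (c0Rec F K k) (WRec N) →ₗ[ℂ]
    BondL2K ℂ (F.P K).d (fun _ => (F.P K).sitesPerDir 0) (c0Rec F K k) (WRec N)) (a : ℝ)
  (hposπ : ∀ x, x ≠ 0 → 0 < RCLike.re ⟪x, laplaceAOfRecordAt F N k U₀ (hessOpOfRecord128 F N k U₀ Gp (QflatOfRecord F N k) Δ2)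
    (QOfRecord F N k U₀) (QflatOfRecord F N k) a x⟫_ℂ)
  (hposb : ∀ x, x ≠ 0 → 0 < RCLike.re ⟪x, laplaceAOfRecord F N k U₀ (QOfRecord F N k U₀) (QflatOfRecord F N k) a x⟫_ℂ)
  (hQ : Function.Surjective (QOfRecord F N k U₀)) (εC : ℝ)

/-! ## §1. `RegimeTok` from the four inputs (R1)–(R4) and the ceilings -/

/-- ★★ **THE `RegimeTok` DISCHARGER**: (R1) (117), (R2) Prop. 4, (R3) (28), (R4) (46)∕(103) and the ceilings (118)–(121) give 3a's `RegimeTok` for the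
scheme of record with `j := C₁B₃ε₁`, `a := 2dL·B₀C₁ε₁` — one call of lit ✓`Regime.ofProp6` per datum (the data do not see the datum).
[cite: Balaban1985Variational, Prop. 6 (117)–(121) p.295, Prop. 4 (98) p.293, (28) p.282, (46) p.285, (103) p.293] -/
theorem bgSchemeOfRecord_regimeTok_of {B₀ C₄ a₃ dL C₁ B₃ ε₁ ε₄ : ℝ}
    (hG : ∀ f, ‖frakGOfRecordAtBg128 F N K k Ω U₀ Gp Δ2 a hposπ hQ f‖ ≤ B₀ * ‖f‖)
    (hW : QuadAnalytic (WOfRecordAt F N K k Ω U₀ levB a hposb hQ εC Gp) C₄ a₃)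
    (hJ : ‖JOfRecordAtBg F N K k Ω U₀‖ ≤ C₁ * B₃ * ε₁)
    (h𝔄 : ∀ V ∈ dom, ‖frakAOfRecordAtBg128 F N K k Ω U₀ levB Gp Δ2 a hposπ hQ V‖ < 2 * dL * B₀ * C₁ * ε₁)
    (hB₀ : 0 ≤ B₀) (hC₄ : 0 ≤ C₄) (hdL : 0 ≤ dL) (hC₁ : 0 ≤ C₁) (hε₁ : 0 ≤ ε₁) (hε₄ : 0 ≤ ε₄) (hB₃ : dL ≤ B₃)
    (h1 : 2 * B₀ * C₁ * B₃ * ε₁ ≤ ε₄) (h2 : 4 * ε₄ ≤ a₃) (h3 : 16 * B₀ * C₄ * ε₄ ≤ 1) :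
    (bgSchemeOfRecord F N K k Ω U₀ dom levB Gp Δ2 a hposπ hposb hQ εC B₀ C₄ a₃ (C₁ * B₃ * ε₁) (2 * dL * B₀ * C₁ * ε₁) ε₄).RegimeTok :=
  fun V hV => ⟨Regime.ofProp6 hG hW hB₀ hC₄ hdL hC₁ hε₁ hε₄ hB₃ h1 h2 h3, hJ, h𝔄 V hV⟩

/-! ## §2. The inputs (R3) and (R4) from the landed letters -/

omit [NeZero N] [Fact (0 < c0Rec F K k)] [Fact (∀ c, 0 < wBRec F K k c)] in
/-- **(R3) = 3d′'s (28)**: under lit's bondwise current clause `InU2cur` at radius `C₁B₃ε₁` (print's (14) read on the plaquette current), `‖J(U₀)‖₍₋₃₎ ≤ C₁B₃ε₁`.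
[cite: Balaban1985Variational, (28) p.282, (14) p.280] -/
theorem regimeInput_J {C₁ B₃ ε₁ : ℝ} (hK : 0 ≤ C₁ * B₃ * ε₁)
    (h14 : InU2cur (F.L : ℝ) ((F.P K).eta k) (bondLevLit F Ω k) (C₁ * B₃ * ε₁) (unitsOfRecord F N U₀)) :
    ‖JOfRecordAtBg F N K k Ω U₀‖ ≤ C₁ * B₃ * ε₁ :=
  norm_JOfRecordAtBg_le (F := F) (N := N) (K := K) (k := k) (Ω := Ω) (U₀ := U₀) hK h14

/-- ★ **(R4) FROM (117)'s `H₁`-BOUND AND 3e′'s (20)**: if `‖H₁(U₀)f‖ ≤ B₀‖f‖` (`0 < B₀`) and the datum obeys `|V(c)(Ū^kU₀)(c)⁻¹ − 1| ≤ C₁ε₁` on every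
level-`k` bond with `0 < C₁ε₁`, `dL·C₁ε₁ ≤ 1/8` (`dL = d·L`, `1 ≤ d`), then `‖𝔄(V)‖ = ‖H₁B(V)‖ < 2dL·B₀C₁ε₁` (3e′ ✓`norm_BOfRecord_lt` = lit (1.37)).
[cite: Balaban1985Variational, (103) p.293, (46) p.285, (20) p.281, (117) p.295; Balaban1985RegularSpaces, (1.37) p.82] -/
theorem regimeInput_frakA {B₀ C₁ ε₁ : ℝ} (hB₀ : 0 < B₀)
    (hH₁ : ∀ f, ‖H1OfRecordAtBg128 F N K k Ω U₀ levB Gp Δ2 a hposπ hQ f‖ ≤ B₀ * ‖f‖)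
    (hα : 0 < C₁ * ε₁) (hd : 1 ≤ (F.P K).d) (hsmall : ((F.P K).d : ℝ) * (F.P K).L * (C₁ * ε₁) ≤ 1 / 8)
    {V : GaugeField (F.P K) k (SU N)}
    (hV : ∀ c : PBond (F.P K) k,
      ‖(V c : Matrix (Fin N) (Fin N) ℂ) * star (Averaging.iter (avOfRecord F N K) k U₀ c : Matrix (Fin N) (Fin N) ℂ) - 1‖ ≤ C₁ * ε₁) :
    ‖frakAOfRecordAtBg128 F N K k Ω U₀ levB Gp Δ2 a hposπ hQ V‖ < 2 * (((F.P K).d : ℝ) * (F.P K).L) * B₀ * C₁ * ε₁ := by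
  have hB : ‖BOfRecord F N K k U₀ levB V‖ < 2 * (F.P K).d * (F.P K).L * (C₁ * ε₁) :=
    norm_BOfRecord_lt F N k U₀ levB V hα hd hsmall hV
  calc ‖frakAOfRecordAtBg128 F N K k Ω U₀ levB Gp Δ2 a hposπ hQ V‖
      = ‖H1OfRecordAtBg128 F N K k Ω U₀ levB Gp Δ2 a hposπ hQ (BOfRecord F N K k U₀ levB V)‖ := rfl
    _ ≤ B₀ * ‖BOfRecord F N K k U₀ levB V‖ := hH₁ _
    _ < B₀ * (2 * (F.P K).d * (F.P K).L * (C₁ * ε₁)) := mul_lt_mul_of_pos_left hB hB₀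
    _ = 2 * (((F.P K).d : ℝ) * (F.P K).L) * B₀ * C₁ * ε₁ := by ring

/-! ## §3. `RegimeTok` from the printed clauses at once -/

/-- ★★★ **`RegimeTok` OF THE SCHEME OF RECORD FROM THE PRINTED CLAUSES**: (117) for `𝔊` and `H₁` (slot (c)), Prop. 4 for `W`, the bondwise current
clause (14)∕(28), the datum clause (14)∕(19)∕(20) on the domain, and the ceilings (118)–(121) — with `dL := d·L`, `j := C₁B₃ε₁`, `a := 2dL·B₀C₁ε₁`.
Every analytic input is a HYPOTHESIS (N06∕N07 lanes); this is the glue. [cite: Balaban1985Variational, Prop. 6 (115)–(121) p.295, Prop. 4 (98) p.293,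
(14) p.280, (19)–(20) p.281, (28) p.282, (46) p.285, (103) p.293] -/
theorem bgSchemeOfRecord_regimeTok_of_print {B₀ C₄ a₃ C₁ B₃ ε₁ ε₄ : ℝ} (hB₀ : 0 < B₀) (hC₄ : 0 ≤ C₄) (hC₁ : 0 ≤ C₁) (hε₁ : 0 ≤ ε₁) (hε₄ : 0 ≤ ε₄)
    (hG : ∀ f, ‖frakGOfRecordAtBg128 F N K k Ω U₀ Gp Δ2 a hposπ hQ f‖ ≤ B₀ * ‖f‖)
    (hH₁ : ∀ f, ‖H1OfRecordAtBg128 F N K k Ω U₀ levB Gp Δ2 a hposπ hQ f‖ ≤ B₀ * ‖f‖)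
    (hW : QuadAnalytic (WOfRecordAt F N K k Ω U₀ levB a hposb hQ εC Gp) C₄ a₃)
    (h14 : InU2cur (F.L : ℝ) ((F.P K).eta k) (bondLevLit F Ω k) (C₁ * B₃ * ε₁) (unitsOfRecord F N U₀))
    (hα : 0 < C₁ * ε₁) (hd : 1 ≤ (F.P K).d) (hsmall : ((F.P K).d : ℝ) * (F.P K).L * (C₁ * ε₁) ≤ 1 / 8)
    (hdom : ∀ V ∈ dom, ∀ c : PBond (F.P K) k,
      ‖(V c : Matrix (Fin N) (Fin N) ℂ) * star (Averaging.iter (avOfRecord F N K) k U₀ c : Matrix (Fin N) (Fin N) ℂ) - 1‖ ≤ C₁ * ε₁)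
    (hB₃ : ((F.P K).d : ℝ) * (F.P K).L ≤ B₃)
    (h1 : 2 * B₀ * C₁ * B₃ * ε₁ ≤ ε₄) (h2 : 4 * ε₄ ≤ a₃) (h3 : 16 * B₀ * C₄ * ε₄ ≤ 1) :
    (bgSchemeOfRecord F N K k Ω U₀ dom levB Gp Δ2 a hposπ hposb hQ εC B₀ C₄ a₃ (C₁ * B₃ * ε₁)
      (2 * (((F.P K).d : ℝ) * (F.P K).L) * B₀ * C₁ * ε₁) ε₄).RegimeTok := by
  have hdL : (0 : ℝ) ≤ ((F.P K).d : ℝ) * (F.P K).L := by positivity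
  have hK : 0 ≤ C₁ * B₃ * ε₁ := mul_nonneg (mul_nonneg hC₁ (hdL.trans hB₃)) hε₁
  exact bgSchemeOfRecord_regimeTok_of F N K k Ω U₀ dom levB Gp Δ2 a hposπ hposb hQ εC hG hW
    (regimeInput_J F N K k Ω U₀ hK h14)
    (fun V hV => regimeInput_frakA F N K k Ω U₀ levB Gp Δ2 a hposπ hQ hB₀ hH₁ hα hd hsmall (hdom V hV))
    hB₀.le hC₄ hdL hC₁ hε₁ hε₄ hB₃ h1 h2 h3

end Record

end Literature.MathematicalPhysics.QuantumFieldTheory.Balaban1983to89.Node00
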